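import Literature.Analysis.FunctionSpaces.PVDefinability
import Literature.Analysis.FunctionSpaces.PVTrueUniversal
import Literature.Computability.MetaComplexity.BoundedArithAlgebra
import HarnessLib

/-!
# Models of `PV₁`: the defining equations, binary notation, and open polynomial induction

Support for the model-theoretic proof of Buss's theorem "`S₂¹(PV)` is `∀Σᵇ₁(PV)`-conservative
over `PV₁`" (`S2PV_one_isConservativeOver_PV1`, `PVTheory.lean`; Buss 1986, Ch. 6, Thm. 6.4 and
Cor. 6.8; Krajíček 1995, Cor. 7.2.4 and Thm. 7.6.3; Avigad 2002, §4).  That proof runs *inside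
an arbitrary model* `M` of `PV₁ = PVdef + BASIC(PV) + open-PIND` (`PV1`), and this file is the
bottom layer of the in-model toolkit:

* `model_BASIC_of_model_PV1` — the `L(S₂)`-reduct `pvReduct M` of a model of `PV₁` is a model
  of `BASIC`, so the ordered-semiring façade `BASICModel` of `BoundedArithAlgebra.lean` (order,
  `0, 1, +, ·`, `|·|`, `⌊·/2⌋`, `#`) is available on `M`;
* the defining axioms `PVdef` read as identities of `papp` (a symbol applied in `M`):
  composition, projections, the initial symbols (`s_b x = 2x + b`, `⌊s_b x / 2⌋ = x`, `cond`,
  `1 # s_b y = s₀ (1 # y)`, …) and the two recursion equations of `limRec g h k` with the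
  truncation `min` (`papp_limRec_zero`, `papp_limRec_bit`), plus the bound `limRec g h k ≤ k`
  which needs no induction (`papp_limRec_le`);
* binary notation in `M`: every `x ≠ 0` is `s_b ⌊x/2⌋` for a unique bit `b` (`exists_eq_bit`),
  order and injectivity of `s_b` (`bit_le_bit_iff`, `bit_lt_bit_iff`, `bit_inj_iff`);
* **open `PIND`** for predicates definable by an open `L(PV)`-formula with parameters
  (`IsQFPVDef.pind`), and its binary-successor form (`IsQFPVDef.bitInd`): the induction
  principle of `PV₁` (Cook 1975, §2, rule R5; Krajíček 1995, Def. 5.3.1);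
* definability bookkeeping: a symbol applied to term functions is a term function
  (`IsPVTermFn.app`), `s_b` of term functions.

## References

* S. A. Cook, *Feasibly constructive proofs and the propositional calculus*, STOC 1975, §2.
* S. R. Buss, *Bounded Arithmetic*, Bibliopolis 1986, §2.2 (`BASIC`), Ch. 6 (`PV₁`, `S₂¹(PV)`).
* J. Krajíček, *Bounded Arithmetic, Propositional Logic and Complexity Theory*, CUP 1995,
  Def. 5.3.1, §5.3.

## Design choices

* As in `PVDefinability.lean`, an `L(PV)`-structure `M` carries the reduct `pvReduct M` as a
  *local* instance; statements use the algebraic notation of `BASICModel` under the instance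
  hypothesis `[M ⊨ BASIC]`, and the `PV₁` hypothesis is the explicit argument `(hM : M ⊨ PV1)`
  (users obtain the instance by `haveI := model_BASIC_of_model_PV1 hM`).
* Binary successors are written `pbit b x := papp (PVFun.bit b) ![x]`; the normal form used in
  statements is `pbit`, with `PV1.pbit_false_eq : pbit false x = 2 * x`, `PV1.pbit_true_eq`.
* The in-model identities live in the namespace `Literature.Analysis.FunctionSpaces.PV1` (the
  unqualified names `papp_comp`, … are taken by the `trueUnivPV` development of
  `PVHerbrandPIND.lean`, whose hypothesis is `K ⊨ trueUnivPV`).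
-/

namespace Literature.Analysis.FunctionSpaces

open FirstOrder FirstOrder.Language FirstOrder.Language.BoundedFormula
open Literature.Computability.MetaComplexity Literature.Computability.MetaComplexity.BASICModel

attribute [local instance] pvReduct isExpansionOn_pvReduct

variable {M : Type} [Language.pv.Structure M]

/-! ## A model of `PV₁` is a model of `BASIC`, of `PVdef`, and of open `PIND` -/

/-- The reduct of a model of `PV₁` is a model of `BASIC` (`PV₁ ⊇ BASIC(PV)`; Buss 1986, Ch. 6).
[cite: Buss1986, Ch. 6] -/
theorem model_BASIC_of_model_PV1 (hM : M ⊨ PV1) : M ⊨ BASIC :=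
  (model_onTheory_boundedArithToPV_iff' BASIC).1
    (hM.mono (Set.subset_union_right.trans Set.subset_union_left))

/-- A model of `PV₁` is a model of the defining axioms `PVdef` (by definition of `PV1`).
[folklore] -/
theorem model_PVdef_of_model_PV1 (hM : M ⊨ PV1) : M ⊨ PVdef :=
  hM.mono PVdef_subset_PV1

/-- A model of `PV₁` satisfies the scheme of open `PIND` (by definition of `PV1`). [folklore] -/
theorem model_openPIND_of_model_PV1 (hM : M ⊨ PV1) : M ⊨ ⋃ k, pvPindAxiom '' openFormulas k :=
  hM.mono Set.subset_union_right

/-! ## Membership of the defining axioms in `PVdef` -/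

section Mem

variable {n m : ℕ}

/-- Composition axioms are axioms of `PVdef`. [folklore] -/
theorem compAxiom_mem_PVdef (f : PVFun m) (g : Fin m → PVFun n) : compAxiom f g ∈ PVdef := by
  refine Or.inl (Or.inl (Or.inr ?_))
  simp only [Set.mem_iUnion, Set.mem_range, Prod.exists]
  exact ⟨n, m, f, g, rfl⟩

/-- Projection axioms are axioms of `PVdef`. [folklore] -/
theorem projAxiom_mem_PVdef (i : Fin n) : projAxiom i ∈ PVdef := by
  refine Or.inl (Or.inl (Or.inl (Or.inr ?_)))
  simp only [Set.mem_iUnion, Set.mem_range]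
  exact ⟨n, i, rfl⟩

/-- Base recursion equations are axioms of `PVdef`. [folklore] -/
theorem limRecZeroAxiom_mem_PVdef (g : PVFun n) (h : Bool → PVFun (n + 2)) (k : PVFun (n + 1)) :
    limRecZeroAxiom g h k ∈ PVdef := by
  refine Or.inl (Or.inr ?_)
  simp only [Set.mem_iUnion, Set.mem_range, Prod.exists]
  exact ⟨n, g, h, k, rfl⟩

/-- Step recursion equations are axioms of `PVdef`. [folklore] -/
theorem limRecBitAxiom_mem_PVdef (b : Bool) (g : PVFun n) (h : Bool → PVFun (n + 2))
    (k : PVFun (n + 1)) : limRecBitAxiom b g h k ∈ PVdef := by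
  refine Or.inr ?_
  simp only [Set.mem_iUnion, Set.mem_range, Prod.exists]
  exact ⟨n, b, g, h, k, rfl⟩

/-- The listed initial equations are axioms of `PVdef`. [folklore] -/
theorem mem_PVdef_of_mem_initialAxioms {φ : Language.pv.Sentence} (hφ : φ ∈ initialAxioms) :
    φ ∈ PVdef :=
  Or.inl (Or.inl (Or.inl (Or.inl hφ)))

/-- The `k`-th listed initial equation is an axiom of `PVdef`. [folklore] -/
theorem getElem_initialAxioms_mem_PVdef (k : ℕ) (hk : k < initialAxioms.length) :
    initialAxioms[k] ∈ PVdef :=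
  mem_PVdef_of_mem_initialAxioms (List.getElem_mem hk)

end Mem

/-! ## Symbols applied in `M`: small realisation lemmas -/

section Papp

variable {n m : ℕ}

/-- The binary successor `s_b x` in `M`. [cite: Cook1975, §2] -/
abbrev pbit (b : Bool) (x : M) : M := papp (PVFun.bit b) ![x]

/-- `cond (x, y, z)` in `M`. [cite: Cobham1965] -/
abbrev pcond (x y z : M) : M := papp PVFun.cond ![x, y, z]

omit [Language.pv.Structure M] in
/-- A `Fin 1`-tuple is `![x 0]`. [folklore] -/
theorem vec1_eq' (x : Fin 1 → M) : x = ![x 0] := by funext i; fin_cases i; rfl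

omit [Language.pv.Structure M] in
/-- A `Fin 2`-tuple is `![x 0, x 1]`. [folklore] -/
theorem vec2_eq' (x : Fin 2 → M) : x = ![x 0, x 1] := by funext i; fin_cases i <;> rfl

omit [Language.pv.Structure M] in
/-- A `Fin 3`-tuple is `![x 0, x 1, x 2]`. [folklore] -/
theorem vec3_eq' (x : Fin 3 → M) : x = ![x 0, x 1, x 2] := by funext i; fin_cases i <;> rfl

/-- Realizing the free variable `xᵢ` (`fvar`). [folklore] -/
@[simp] theorem realize_fvar (v : Fin n → M) (w : Fin 0 → M) (i : Fin n) :
    (fvar i).realize (Sum.elim v w) = v i := rfl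

/-- Realizing `pvApp f ts`. [folklore] -/
theorem realize_pvApp {α : Type} (f : PVFun m) (ts : Fin m → Language.pv.Term α) (v : α → M) :
    (pvApp f ts).realize v = papp f fun i => (ts i).realize v := rfl

/-- Realizing `pvBit` in `M`. [folklore] -/
@[simp] theorem realize_pvBit' {α : Type} (b : Bool) (t : Language.pv.Term α) (v : α → M) :
    (pvBit b t).realize v = pbit b (t.realize v) := by
  rw [pvBit, Term.realize_functions_apply₁]

/-- Realizing `pvCond` in `M`. [folklore] -/
@[simp] theorem realize_pvCond' {α : Type} (t₁ t₂ t₃ : Language.pv.Term α) (v : α → M) :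
    (pvCond t₁ t₂ t₃).realize v = pcond (t₁.realize v) (t₂.realize v) (t₃.realize v) := by
  rw [pvCond, realize_pvApp]
  congr 1; funext i; fin_cases i <;> rfl

end Papp

/-! ## The defining axioms as identities in a model of `PVdef` -/

namespace PV1

section PVdefFacts

variable {n m : ℕ}

/-- **Composition** in a model of `PVdef`: `(f ∘ ḡ)(x̄) = f(g₀ x̄, …)`. [cite: Cook1975, §2] -/
theorem papp_comp (hD : M ⊨ PVdef) (f : PVFun m) (g : Fin m → PVFun n) (xs : Fin n → M) :
    papp (PVFun.comp f g) xs = papp f fun j => papp (g j) xs := by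
  have h := (realize_closeFin _).1 (hD.realize_of_mem _ (compAxiom_mem_PVdef f g)) xs
  simpa [Formula.Realize, realize_pvApp] using h

/-- **Projections** in a model of `PVdef`: `πᵢ(x̄) = xᵢ`. [cite: Cobham1965] -/
theorem papp_proj (hD : M ⊨ PVdef) (i : Fin n) (xs : Fin n → M) :
    papp (PVFun.proj i) xs = xs i := by
  have h := (realize_closeFin _).1 (hD.realize_of_mem _ (projAxiom_mem_PVdef i)) xs
  simpa [Formula.Realize, realize_pvApp] using h

variable [hB : M ⊨ BASIC]

/-- What `minFormula f a c` says in `M`: `f = min a c`. [folklore] -/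
theorem realize_minFormula' {α : Type} {l : ℕ} (f a c : Language.pv.Term (α ⊕ Fin l))
    (v : α → M) (xs : Fin l → M) :
    (minFormula f a c).Realize v xs ↔
      f.realize (Sum.elim v xs) = min (a.realize (Sum.elim v xs)) (c.realize (Sum.elim v xs)) := by
  simp only [minFormula, realize_inf, realize_imp, realize_not, realize_bdEqual, realize_pvle]
  rcases le_total (a.realize (Sum.elim v xs)) (c.realize (Sum.elim v xs)) with h | h
  · simp only [h, min_eq_left h, forall_const, not_true_eq_false, IsEmpty.forall_iff, and_true]
  · rcases h.lt_or_eq with h' | h'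
    · simp only [not_le.2 h', min_eq_right h, IsEmpty.forall_iff, not_false_eq_true,
        forall_const, true_and]
    · simp only [h', le_refl, min_self, forall_const, not_true_eq_false, IsEmpty.forall_iff,
        and_true]

/-- **Base equation of limited recursion on notation** in a model of `PVdef`:
`F(x̄, 0) = min (g x̄) (k(x̄, 0))`. [cite: Cook1975, §2] -/
theorem papp_limRec_zero (hD : M ⊨ PVdef) (g : PVFun n) (h : Bool → PVFun (n + 2))
    (k : PVFun (n + 1)) (xs : Fin n → M) :
    papp (PVFun.limRec g h k) (Fin.snoc xs 0) =
      min (papp g xs) (papp k (Fin.snoc xs 0)) := by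
  have h1 := (realize_closeFin _).1 (hD.realize_of_mem _ (limRecZeroAxiom_mem_PVdef g h k)) xs
  simp only [Formula.Realize, realize_minFormula', realize_pvApp, QSym.realize_snoc_terms,
    realize_fvar, realize_pv_zero', mZero_eq] at h1
  exact h1

/-- **Step equation of limited recursion on notation** in a model of `PVdef`: for `s_b y ≠ 0`,
`F(x̄, s_b y) = min (h_b(x̄, y, F(x̄, y))) (k(x̄, s_b y))`. [cite: Cook1975, §2] -/
theorem papp_limRec_bit (hD : M ⊨ PVdef) (b : Bool) (g : PVFun n) (h : Bool → PVFun (n + 2))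
    (k : PVFun (n + 1)) (xs : Fin n → M) (y : M) (hy : pbit b y ≠ 0) :
    papp (PVFun.limRec g h k) (Fin.snoc xs (pbit b y)) =
      min (papp (h b) (Fin.snoc (Fin.snoc xs y) (papp (PVFun.limRec g h k) (Fin.snoc xs y))))
        (papp k (Fin.snoc xs (pbit b y))) := by
  have h1 := (realize_closeFin _).1 (hD.realize_of_mem _ (limRecBitAxiom_mem_PVdef b g h k))
    (Fin.snoc xs y)
  simp only [Formula.Realize, realize_imp, realize_not, realize_bdEqual,
    realize_minFormula', realize_pvApp, QSym.realize_snoc_terms, realize_fvar, realize_pvBit',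
    realize_pv_zero', mZero_eq, Fin.snoc_castSucc, Fin.snoc_last] at h1
  exact h1 hy

omit hB in
/-- Extracting the `k`-th initial equation as a statement about `M`. [folklore] -/
private theorem initial (hD : M ⊨ PVdef) (k : ℕ) (hk : k < initialAxioms.length) :
    M ⊨ initialAxioms[k] :=
  hD.realize_of_mem _ (getElem_initialAxioms_mem_PVdef k hk)

/-- `s₀ x = x + x = 2x` in a model of `PVdef` (first initial equation). [cite: Cook1975, §2] -/
theorem pbit_false_eq (hD : M ⊨ PVdef) (x : M) : pbit false x = 2 * x := by
  have h1 := initial hD 0 (by simp [initialAxioms])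
  change M ⊨ alls (n := 1) (pvBit false &0 =' (&0 + &0)) at h1
  simp only [Sentence.Realize, realize_alls, realize_bdEqual, realize_pvBit', realize_pv_add',
    mAdd_eq] at h1
  rw [two_mul]
  exact h1 ![x]

/-- `s₁ x = S(x + x) = 2x + 1` in a model of `PVdef`. [cite: Cook1975, §2] -/
theorem pbit_true_eq (hD : M ⊨ PVdef) (x : M) : pbit true x = 2 * x + 1 := by
  have h1 := initial hD 1 (by simp [initialAxioms])
  change M ⊨ alls (n := 1) (pvBit true &0 =' pvSucc (&0 + &0)) at h1
  simp only [Sentence.Realize, realize_alls, realize_bdEqual, realize_pvBit', realize_pvSucc',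
    realize_pv_add', mAdd_eq, mSucc_eq] at h1
  rw [two_mul]
  exact h1 ![x]

/-- `s_b x = 2x + b` in a model of `PVdef`, uniformly in the bit. [cite: Cook1975, §2] -/
theorem pbit_eq (hD : M ⊨ PVdef) (b : Bool) (x : M) :
    pbit b x = 2 * x + (if b then 1 else 0) := by
  cases b
  · rw [pbit_false_eq hD, if_neg Bool.false_ne_true, add_zero]
  · rw [pbit_true_eq hD, if_pos rfl]

omit hB in
/-- `⌊s₀ x / 2⌋ = x` in a model of `PVdef`. [cite: Cook1975, §2] -/
theorem mHalf_pbit_false (hD : M ⊨ PVdef) (x : M) : mHalf (pbit false x) = x := by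
  have h1 := initial hD 2 (by simp [initialAxioms])
  change M ⊨ alls (n := 1) (pvHalf (pvBit false &0) =' &0) at h1
  simp only [Sentence.Realize, realize_alls, realize_bdEqual, realize_pvHalf', realize_pvBit'] at h1
  exact h1 ![x]

omit hB in
/-- `⌊s₁ x / 2⌋ = x` in a model of `PVdef`. [cite: Cook1975, §2] -/
theorem mHalf_pbit_true (hD : M ⊨ PVdef) (x : M) : mHalf (pbit true x) = x := by
  have h1 := initial hD 3 (by simp [initialAxioms])
  change M ⊨ alls (n := 1) (pvHalf (pvBit true &0) =' &0) at h1
  simp only [Sentence.Realize, realize_alls, realize_bdEqual, realize_pvHalf', realize_pvBit'] at h1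
  exact h1 ![x]

omit hB in
/-- `⌊s_b x / 2⌋ = x` in a model of `PVdef`. [cite: Cook1975, §2] -/
@[simp] theorem mHalf_pbit (hD : M ⊨ PVdef) (b : Bool) (x : M) : mHalf (pbit b x) = x := by
  cases b
  · exact mHalf_pbit_false hD x
  · exact mHalf_pbit_true hD x

/-- `⌊0 / 2⌋ = 0` in a model of `PVdef`. [cite: Cook1975, §2] -/
@[simp] theorem mHalf_zero' (hD : M ⊨ PVdef) : mHalf (0 : M) = 0 := by
  have h1 := initial hD 4 (by simp [initialAxioms])
  change M ⊨ alls (n := 0) (pvHalf 0 =' 0) at h1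
  simp only [Sentence.Realize, realize_alls, realize_bdEqual, realize_pvHalf', realize_pv_zero',
    mZero_eq] at h1
  exact h1 default

/-- `cond (0, y, z) = y` in a model of `PVdef`. [cite: Cobham1965] -/
@[simp] theorem pcond_zero (hD : M ⊨ PVdef) (y z : M) : pcond 0 y z = y := by
  have h1 := initial hD 18 (by simp [initialAxioms])
  change M ⊨ alls (n := 3) (pvCond 0 &1 &2 =' &1) at h1
  simp only [Sentence.Realize, realize_alls, realize_bdEqual, realize_pvCond', realize_pv_zero',
    mZero_eq] at h1
  exact h1 ![0, y, z]

/-- `cond (s_b x, y, z) = z` for `s_b x ≠ 0` in a model of `PVdef`. [cite: Cobham1965] -/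
theorem pcond_pbit (hD : M ⊨ PVdef) (b : Bool) (x y z : M) (hx : pbit b x ≠ 0) :
    pcond (pbit b x) y z = z := by
  cases b
  · have h1 := initial hD 19 (by simp [initialAxioms])
    change M ⊨ alls (n := 3) (∼(pvBit false &0 =' 0) ⟹ (pvCond (pvBit false &0) &1 &2 =' &2))
      at h1
    simp only [Sentence.Realize, realize_alls, realize_imp, realize_not, realize_bdEqual,
      realize_pvCond', realize_pvBit', realize_pv_zero', mZero_eq] at h1
    exact h1 ![x, y, z] hx
  · have h1 := initial hD 20 (by simp [initialAxioms])
    change M ⊨ alls (n := 3) (pvCond (pvBit true &0) &1 &2 =' &2) at h1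
    simp only [Sentence.Realize, realize_alls, realize_bdEqual, realize_pvCond', realize_pvBit'] at h1
    exact h1 ![x, y, z]

/-- `x # 0 = 1` in a model of `PVdef`. [cite: Buss1986, §2.2] -/
theorem mSmash_zero' (hD : M ⊨ PVdef) (x : M) : mSmash x 0 = 1 := by
  have h1 := initial hD 8 (by simp [initialAxioms])
  change M ⊨ alls (n := 1) (pvSmash &0 0 =' pvSucc 0) at h1
  simp only [Sentence.Realize, realize_alls, realize_bdEqual, realize_pvSmash', realize_pvSucc',
    realize_pv_zero', mZero_eq, mSucc_eq, zero_add] at h1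
  exact h1 ![x]

/-- `x # s_b y = (x # y) · (1 # x)` for `s_b y ≠ 0` in a model of `PVdef`. [cite: Buss1986, §2.2] -/
theorem mSmash_pbit (hD : M ⊨ PVdef) (b : Bool) (x y : M) (hy : pbit b y ≠ 0) :
    mSmash x (pbit b y) = mSmash x y * mSmash 1 x := by
  cases b
  · have h1 := initial hD 9 (by simp [initialAxioms])
    change M ⊨ alls (n := 2) (∼(pvBit false &1 =' 0) ⟹
      (pvSmash &0 (pvBit false &1) =' (pvSmash &0 &1 * pvSmash (pvSucc 0) &0))) at h1
    simp only [Sentence.Realize, realize_alls, realize_imp, realize_not, realize_bdEqual,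
      realize_pvSmash', realize_pvBit', realize_pvSucc', realize_pv_mul', realize_pv_zero',
      mZero_eq, mSucc_eq, mMul_eq, zero_add] at h1
    exact h1 ![x, y] hy
  · have h1 := initial hD 10 (by simp [initialAxioms])
    change M ⊨ alls (n := 2)
      (pvSmash &0 (pvBit true &1) =' (pvSmash &0 &1 * pvSmash (pvSucc 0) &0)) at h1
    simp only [Sentence.Realize, realize_alls, realize_bdEqual, realize_pvSmash', realize_pvBit',
      realize_pvSucc', realize_pv_mul', realize_pv_zero', mZero_eq, mSucc_eq, mMul_eq, zero_add] at h1
    exact h1 ![x, y]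

/-- `1 # s_b y = s₀ (1 # y)` for `s_b y ≠ 0` in a model of `PVdef`. [cite: Buss1986, §2.2] -/
theorem one_mSmash_pbit (hD : M ⊨ PVdef) (b : Bool) (y : M) (hy : pbit b y ≠ 0) :
    mSmash 1 (pbit b y) = pbit false (mSmash 1 y) := by
  cases b
  · have h1 := initial hD 12 (by simp [initialAxioms])
    change M ⊨ alls (n := 1) (∼(pvBit false &0 =' 0) ⟹
      (pvSmash (pvSucc 0) (pvBit false &0) =' pvBit false (pvSmash (pvSucc 0) &0))) at h1
    simp only [Sentence.Realize, realize_alls, realize_imp, realize_not, realize_bdEqual,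
      realize_pvSmash', realize_pvBit', realize_pvSucc', realize_pv_zero', mZero_eq, mSucc_eq,
      zero_add] at h1
    exact h1 ![y] hy
  · have h1 := initial hD 13 (by simp [initialAxioms])
    change M ⊨ alls (n := 1)
      (pvSmash (pvSucc 0) (pvBit true &0) =' pvBit false (pvSmash (pvSucc 0) &0)) at h1
    simp only [Sentence.Realize, realize_alls, realize_bdEqual, realize_pvSmash', realize_pvBit',
      realize_pvSucc', realize_pv_zero', mZero_eq, mSucc_eq, zero_add] at h1
    exact h1 ![y]

end PVdefFacts

/-! ## Binary notation in a model of `BASIC + PVdef` -/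

section Notation

variable [hB : M ⊨ BASIC]

/-- `s₁ x ≠ 0`. [folklore] -/
theorem pbit_true_ne_zero (hD : M ⊨ PVdef) (x : M) : pbit true x ≠ 0 := by
  rw [pbit_true_eq hD]; exact ne_bot_of_gt (lt_add_one' (2 * x))

/-- `s₀ x ≠ 0 ↔ x ≠ 0`. [folklore] -/
theorem pbit_false_ne_zero_iff (hD : M ⊨ PVdef) (x : M) : pbit false x ≠ 0 ↔ x ≠ 0 := by
  rw [pbit_false_eq hD]
  refine ⟨fun h hx => h (by rw [hx, mul_zero]), fun h => two_mul_ne_zero' h⟩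

/-- `s_b x ≠ 0` unless `b = false` and `x = 0`. [folklore] -/
theorem pbit_ne_zero (hD : M ⊨ PVdef) {b : Bool} {x : M} (h : x = 0 → b = true) :
    pbit b x ≠ 0 := by
  cases b
  · exact (pbit_false_ne_zero_iff hD x).2 fun hx => Bool.false_ne_true (h hx)
  · exact pbit_true_ne_zero hD x

/-- `s₀ 0 = 0`. [folklore] -/
@[simp] theorem pbit_false_zero (hD : M ⊨ PVdef) : pbit false (0 : M) = 0 := by
  rw [pbit_false_eq hD, mul_zero]

/-- **Binary notation**: every `x ≠ 0` is `s_b ⌊x/2⌋` for some bit `b` (`BASIC` axiom 32 and the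
defining equations of `s₀, s₁`). [cite: Buss1986, §2.2] -/
theorem exists_eq_pbit_mHalf (hD : M ⊨ PVdef) (x : M) (hx : x ≠ 0) :
    ∃ b : Bool, x = pbit b (mHalf x) ∧ pbit b (mHalf x) ≠ 0 := by
  rcases two_mul_mHalf_or x with h | h
  · refine ⟨false, ?_, ?_⟩ <;> rw [pbit_false_eq hD]
    · exact h.symm
    · rwa [h]
  · refine ⟨true, ?_, ?_⟩ <;> rw [pbit_true_eq hD]
    · exact h.symm
    · rwa [h]

/-- Trichotomy of notation: `x = 0`, or `x = s₀ ⌊x/2⌋ ≠ 0`, or `x = s₁ ⌊x/2⌋`. [cite: Buss1986, §2.2] -/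
theorem eq_zero_or_eq_pbit (hD : M ⊨ PVdef) (x : M) :
    x = 0 ∨ ∃ b : Bool, x = pbit b (mHalf x) ∧ pbit b (mHalf x) ≠ 0 := by
  by_cases hx : x = 0
  · exact Or.inl hx
  · exact Or.inr (exists_eq_pbit_mHalf hD x hx)

/-- `s_b x = s_c y ↔ x = y ∧ b = c`. [folklore] -/
theorem pbit_inj_iff (hD : M ⊨ PVdef) {b c : Bool} {x y : M} :
    pbit b x = pbit c y ↔ x = y ∧ b = c := by
  constructor
  · intro h
    cases b <;> cases c
    · rw [pbit_false_eq hD, pbit_false_eq hD] at h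
      exact ⟨two_mul_cancel h, rfl⟩
    · rw [pbit_false_eq hD, pbit_true_eq hD] at h
      exact absurd h (two_mul_ne_two_mul_add_one x y)
    · rw [pbit_true_eq hD, pbit_false_eq hD] at h
      exact absurd h.symm (two_mul_ne_two_mul_add_one y x)
    · rw [pbit_true_eq hD, pbit_true_eq hD] at h
      exact ⟨two_mul_cancel (add_right_cancel h), rfl⟩
  · rintro ⟨rfl, rfl⟩; rfl

/-- `2x < 2y ↔ x < y`. [folklore] -/
theorem two_mul_lt_two_mul_iff' (x y : M) : 2 * x < 2 * y ↔ x < y := by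
  rw [← not_le, two_mul_le_two_mul_iff, not_le]

/-- `2x + 1 ≤ 2y ↔ x < y`. [folklore] -/
theorem two_mul_add_one_le_two_mul_iff (x y : M) : 2 * x + 1 ≤ 2 * y ↔ x < y := by
  rw [add_one_le_iff', two_mul_lt_two_mul_iff']

/-- `2x + 1 < 2y ↔ x < y`. [folklore] -/
theorem two_mul_add_one_lt_two_mul_iff (x y : M) : 2 * x + 1 < 2 * y ↔ x < y := by
  constructor
  · intro h
    by_contra hle
    rw [not_lt] at hle
    have h2 : 2 * y ≤ 2 * x := (two_mul_le_two_mul_iff y x).2 hle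
    exact lt_irrefl _ (((lt_add_one' _).trans h).trans_le h2)
  · exact two_mul_add_one_lt_two_mul x y

/-- `2x < 2y + 1 ↔ x ≤ y`. [folklore] -/
theorem two_mul_lt_two_mul_add_one_iff (x y : M) : 2 * x < 2 * y + 1 ↔ x ≤ y := by
  rw [lt_add_one_iff', two_mul_le_two_mul_iff]

/-- `2x ≤ 2y + 1 ↔ x ≤ y`. [folklore] -/
theorem two_mul_le_two_mul_add_one_iff (x y : M) : 2 * x ≤ 2 * y + 1 ↔ x ≤ y := by
  constructor
  · intro h
    by_contra hlt
    rw [not_le] at hlt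
    have := (two_mul_add_one_lt_two_mul_iff y x).2 hlt
    exact absurd (h.trans_lt this) (lt_irrefl _)
  · intro h
    exact ((two_mul_le_two_mul_iff x y).2 h).trans (le_add_right'' _ _)

/-- The numeric value of a bit. [folklore] -/
abbrev bitVal (b : Bool) : M := if b then 1 else 0

omit hB in
/-- `s_b x = 2x + bitVal b`. [folklore] -/
theorem pbit_eq' [M ⊨ BASIC] (hD : M ⊨ PVdef) (b : Bool) (x : M) : pbit b x = 2 * x + bitVal b :=
  pbit_eq hD b x

/-- **Order of binary successors**: `s_b x < s_c y ↔ x < y ∨ (x = y ∧ b < c)`. [folklore] -/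
theorem pbit_lt_pbit_iff (hD : M ⊨ PVdef) (b c : Bool) (x y : M) :
    pbit b x < pbit c y ↔ x < y ∨ (x = y ∧ b = false ∧ c = true) := by
  cases b <;> cases c <;> simp only [pbit_false_eq hD, pbit_true_eq hD, Bool.false_eq_true,
    Bool.true_eq_false, and_false, and_true, or_false]
  · exact two_mul_lt_two_mul_iff' x y
  · rw [two_mul_lt_two_mul_add_one_iff, le_iff_lt_or_eq]
  · exact two_mul_add_one_lt_two_mul_iff x y
  · rw [add_lt_add_iff_right, two_mul_lt_two_mul_iff']

/-- **Order of binary successors**: `s_b x ≤ s_c y ↔ x < y ∨ (x = y ∧ b ≤ c)`. [folklore] -/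
theorem pbit_le_pbit_iff (hD : M ⊨ PVdef) (b c : Bool) (x y : M) :
    pbit b x ≤ pbit c y ↔ x < y ∨ (x = y ∧ (b = true → c = true)) := by
  cases b <;> cases c <;> simp only [pbit_false_eq hD, pbit_true_eq hD, Bool.false_eq_true,
    imp_self, and_true, implies_true, and_false, or_false, forall_const]
  · rw [two_mul_le_two_mul_iff, le_iff_lt_or_eq]
  · rw [two_mul_le_two_mul_add_one_iff, le_iff_lt_or_eq]
  · exact two_mul_add_one_le_two_mul_iff x y
  · rw [add_le_add_iff_right, two_mul_le_two_mul_iff, le_iff_lt_or_eq]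

/-- `|s_b x| = |x| + 1` for `s_b x ≠ 0`. [cite: Buss1986, §2.2] -/
theorem mLen_pbit (hD : M ⊨ PVdef) {b : Bool} {x : M} (h : pbit b x ≠ 0) :
    mLen (pbit b x) = mLen x + 1 := by
  cases b
  · have hx : x ≠ 0 := (pbit_false_ne_zero_iff hD x).1 h
    rw [pbit_false_eq hD, mLen_two_mul hx]
  · rw [pbit_true_eq hD, mLen_two_mul_add_one]

/-- `x ≤ s_b x`. [folklore] -/
theorem le_pbit (hD : M ⊨ PVdef) (b : Bool) (x : M) : x ≤ pbit b x := by
  rw [pbit_eq hD, two_mul, add_assoc]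
  exact le_add_right'' _ _

/-- `⌊x/2⌋` is monotone (from `BASIC`). [cite: Buss1986, §2.2] -/
theorem mHalf_le_mHalf (hD : M ⊨ PVdef) {x y : M} (h : x ≤ y) : mHalf x ≤ mHalf y := by
  by_contra hlt
  rw [not_le] at hlt
  rcases eq_zero_or_eq_pbit hD x with hx | ⟨b, hx, -⟩
  · rw [hx, mHalf_zero' hD] at hlt
    exact absurd hlt bot_le.not_gt
  rcases eq_zero_or_eq_pbit hD y with hy | ⟨c, hy, -⟩
  · rw [hy] at h
    have hx0 : x = 0 := le_antisymm h bot_le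
    rw [hx0, mHalf_zero' hD] at hlt
    exact absurd hlt bot_le.not_gt
  · have hlt' : pbit c (mHalf y) < pbit b (mHalf x) :=
      (pbit_lt_pbit_iff hD c b _ _).2 (Or.inl hlt)
    rw [← hx, ← hy] at hlt'
    exact absurd h hlt'.not_ge

end Notation

/-! ## Untruncated recursion equations and the bound `limRec g h k ≤ k` -/

section LimRec

variable [hB : M ⊨ BASIC] {n : ℕ}

/-- **`limRec g h k ≤ k`** pointwise, in every model of `PVdef + BASIC` (no induction: every `y`
is `0` or some `s_b y'`, and both recursion equations truncate by `k`). [cite: Cobham1965] -/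
theorem papp_limRec_le (hD : M ⊨ PVdef) (g : PVFun n) (h : Bool → PVFun (n + 2))
    (k : PVFun (n + 1)) (xs : Fin n → M) (y : M) :
    papp (PVFun.limRec g h k) (Fin.snoc xs y) ≤ papp k (Fin.snoc xs y) := by
  rcases eq_zero_or_eq_pbit hD y with rfl | ⟨b, hy, hne⟩
  · rw [papp_limRec_zero hD]; exact min_le_right _ _
  · rw [hy, papp_limRec_bit hD b g h k xs _ hne]; exact min_le_right _ _

/-- The base equation without truncation, when the bound is respected. [cite: Cook1975, §2] -/
theorem papp_limRec_zero_of_le (hD : M ⊨ PVdef) (g : PVFun n) (h : Bool → PVFun (n + 2))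
    (k : PVFun (n + 1)) (xs : Fin n → M) (hle : papp g xs ≤ papp k (Fin.snoc xs 0)) :
    papp (PVFun.limRec g h k) (Fin.snoc xs 0) = papp g xs := by
  rw [papp_limRec_zero hD, min_eq_left hle]

/-- The step equation without truncation, when the bound is respected. [cite: Cook1975, §2] -/
theorem papp_limRec_bit_of_le (hD : M ⊨ PVdef) (b : Bool) (g : PVFun n)
    (h : Bool → PVFun (n + 2)) (k : PVFun (n + 1)) (xs : Fin n → M) (y : M)
    (hy : pbit b y ≠ 0)
    (hle : papp (h b) (Fin.snoc (Fin.snoc xs y) (papp (PVFun.limRec g h k) (Fin.snoc xs y))) ≤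
      papp k (Fin.snoc xs (pbit b y))) :
    papp (PVFun.limRec g h k) (Fin.snoc xs (pbit b y)) =
      papp (h b) (Fin.snoc (Fin.snoc xs y) (papp (PVFun.limRec g h k) (Fin.snoc xs y))) := by
  rw [papp_limRec_bit hD b g h k xs y hy, min_eq_left hle]

end LimRec

end PV1

/-! ## Open `PIND` in a model of `PV₁` -/

section PIND

/-- An open-definable (with parameters) unary predicate is an instance, at finitely many
parameters, of an open formula with variables `Fin (k + 1)` (enumerate the parameters that
occur; as `exists_formula_fin_of_isSigmabPVDef`). [folklore] -/
theorem exists_formula_fin_of_isQFPVDef {P : (Fin 1 → M) → Prop} (hP : IsQFPVDef P) :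
    ∃ (k : ℕ) (ψ : Language.pv.Formula (Fin (k + 1))) (p : Fin k → M),
      ψ.IsQF ∧ ∀ a, P ![a] ↔ ψ.Realize (Fin.snoc p a) := by
  classical
  obtain ⟨φ, hφ, h⟩ := hP
  let S : Finset (M ⊕ Fin 1) := φ.freeVarFinset
  let k : ℕ := S.card
  let e : ↥S ≃ Fin k := S.equivFin
  let g : M ⊕ Fin 1 → Fin (k + 1) := fun x =>
    Sum.elim (fun a => if hx : (Sum.inl a : M ⊕ Fin 1) ∈ S then Fin.castSucc (e ⟨Sum.inl a, hx⟩)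
      else Fin.last k) (fun _ => Fin.last k) x
  let p : Fin k → M := fun j => Sum.elim id (fun _ => mZero M) (e.symm j).1
  refine ⟨k, φ.relabel g, p, hφ.relabel _, fun a => ?_⟩
  rw [h, Formula.realize_relabel]
  refine realize_congr_freeVarFinset φ default fun x hx => ?_
  rcases x with b | j
  · have hb : (Sum.inl b : M ⊕ Fin 1) ∈ S := hx
    simp only [Function.comp_apply, g, Sum.elim_inl, dif_pos hb, Fin.snoc_castSucc, p,
      Equiv.symm_apply_apply]
  · have hj : j = 0 := Subsingleton.elim _ _
    subst hj
    simp [g]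

variable [hB : M ⊨ BASIC]

/-- **Open `PIND` in a model of `PV₁`**: if `P ⊆ M` is definable by an open `L(PV)`-formula with
parameters, `P(0)` and `∀ a (P(⌊a/2⌋) → P(a))`, then `P = M` (Cook 1975, §2; Krajíček 1995,
Def. 5.3.1: `PV₁` has `PIND` for open formulas). [cite: Krajicek1995, Def. 5.3.1] -/
theorem IsQFPVDef.pind (hM : M ⊨ PV1) {P : M → Prop}
    (hP : IsQFPVDef fun v : Fin 1 → M => P (v 0)) (h0 : P 0)
    (hs : ∀ a, P (mHalf a) → P a) (a : M) : P a := by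
  obtain ⟨k, ψ, p, hψ, h⟩ := exists_formula_fin_of_isQFPVDef hP
  have hmem : pvPindAxiom ψ ∈ PV1 :=
    Or.inr (Set.mem_iUnion.2 ⟨k, Set.mem_image_of_mem _ hψ⟩)
  have hax := (realize_pvPindAxiom_iff ψ).1 (hM.realize_of_mem _ hmem) p
  simp only [← h] at hax
  exact hax h0 hs a

/-- **Induction on binary notation in a model of `PV₁`** for open-definable predicates: from
`P(0)` and `P(x) → P(s_b x)` (for `s_b x ≠ 0`) conclude `∀ x P(x)`. [cite: Cook1975, §2] -/
theorem IsQFPVDef.bitInd (hM : M ⊨ PV1) {P : M → Prop}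
    (hP : IsQFPVDef fun v : Fin 1 → M => P (v 0)) (h0 : P 0)
    (hs : ∀ (b : Bool) (x : M), pbit b x ≠ 0 → P x → P (pbit b x)) (a : M) : P a := by
  have hD := model_PVdef_of_model_PV1 hM
  refine hP.pind hM h0 (fun a ih => ?_) a
  rcases PV1.eq_zero_or_eq_pbit hD a with rfl | ⟨b, ha, hne⟩
  · exact h0
  · rw [ha]; exact hs b _ hne ih

end PIND

/-! ## Definability bookkeeping -/

section Definability

variable {m n : ℕ}

/-- **A symbol applied to term functions is a term function.** [folklore] -/
theorem IsPVTermFn.app (f : PVFun n) {F : Fin n → (Fin m → M) → M}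
    (hF : ∀ i, IsPVTermFn (F i)) : IsPVTermFn fun xs => papp f fun i => F i xs := by
  choose t ht using hF
  refine ⟨Term.func f t, fun xs => ?_⟩
  simp only [Term.realize, ht]

/-- `s_b` of a term function is a term function. [folklore] -/
theorem IsPVTermFn.bit (b : Bool) {F : (Fin m → M) → M} (hF : IsPVTermFn F) :
    IsPVTermFn fun xs => pbit b (F xs) := by
  refine (IsPVTermFn.app (PVFun.bit b) (F := fun _ => F) fun _ => hF).of_eq fun xs => ?_
  simp only [pbit]
  congr 1; funext i; fin_cases i; rfl

/-- A symbol applied to the argument tuple extended by a term function (the shape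
`papp F (Fin.snoc xs (G xs))`) is a term function. [folklore] -/
theorem IsPVTermFn.app_snoc (f : PVFun (m + 1)) {G : (Fin m → M) → M} (hG : IsPVTermFn G) :
    IsPVTermFn fun xs => papp f (Fin.snoc xs (G xs)) := by
  refine (IsPVTermFn.app f (F := fun i xs => (Fin.snoc xs (G xs) : Fin (m + 1) → M) i)
    fun i => ?_).of_eq fun xs => rfl
  cases i using Fin.lastCases with
  | last => simpa using hG
  | cast i => simpa using IsPVTermFn.proj i

/-- A symbol applied to the argument tuple itself is a term function. [folklore] -/
theorem IsPVTermFn.app_id (f : PVFun m) : IsPVTermFn fun xs : Fin m → M => papp f xs :=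
  IsPVTermFn.app f fun i => IsPVTermFn.proj i

variable [hB : M ⊨ BASIC] {P Q : (Fin m → M) → Prop} {F G : (Fin m → M) → M}

/-- `F x̄ ≤ G x̄` is open-definable (algebraic notation). [folklore] -/
theorem IsQFPVDef.le' (hF : IsPVTermFn F) (hG : IsPVTermFn G) : IsQFPVDef fun xs => F xs ≤ G xs :=
  IsQFPVDef.le hF hG

/-- `F x̄ < G x̄` is open-definable. [folklore] -/
theorem IsQFPVDef.lt' (hF : IsPVTermFn F) (hG : IsPVTermFn G) : IsQFPVDef fun xs => F xs < G xs :=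
  (IsQFPVDef.le hG hF).not.of_iff fun _ => (not_congr (mLe_iff _ _)).trans not_le

omit hB in
/-- `F x̄ ≠ G x̄` is open-definable. [folklore] -/
theorem IsQFPVDef.ne' (hF : IsPVTermFn F) (hG : IsPVTermFn G) : IsQFPVDef fun xs => F xs ≠ G xs :=
  (IsQFPVDef.eq hF hG).not

omit hB in
/-- Open-definable predicates are closed under `∨`. [folklore] -/
theorem IsQFPVDef.or (hP : IsQFPVDef P) (hQ : IsQFPVDef Q) : IsQFPVDef fun xs => P xs ∨ Q xs :=
  (hP.not.imp hQ).of_iff fun xs => by tauto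

omit hB in
/-- Open-definable predicates are closed under `↔`. [folklore] -/
theorem IsQFPVDef.iff (hP : IsQFPVDef P) (hQ : IsQFPVDef Q) : IsQFPVDef fun xs => (P xs ↔ Q xs) :=
  ((hP.imp hQ).and (hQ.imp hP)).of_iff fun _ => iff_def.symm

omit hB in
/-- The constantly true predicate is open-definable. [folklore] -/
theorem IsQFPVDef.true : IsQFPVDef fun _ : Fin m → M => True :=
  ((IsQFPVDef.eq (IsPVTermFn.zero (m := m)) IsPVTermFn.zero)).of_iff fun _ => by simp

/-- `1` is a term function. [folklore] -/
theorem IsPVTermFn.one : IsPVTermFn fun _ : Fin m → M => (1 : M) :=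
  IsPVTermFn.zero.succ

/-- `2` is a term function. [folklore] -/
theorem IsPVTermFn.two : IsPVTermFn fun _ : Fin m → M => (2 : M) :=
  (IsPVTermFn.zero.succ.succ).of_eq fun _ => by
    simp only [mSucc_eq, mZero_eq, zero_add]; exact one_add_one_eq_two

end Definability

end Literature.Analysis.FunctionSpaces
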